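import Literature.Computability.Complexity.ExtMonotoneGRankSupport
import Summits.PneNP.PneNP.Theorems.ConvexRankGatesBpmIsOneRankGate
import Mathlib.LinearAlgebra.Matrix.Kronecker
import Mathlib.Data.Matrix.ColumnRowPartitioned
import HarnessLib

/-!
# Crux `Capture` (stmt-PneNP-2659) — GRANK door algebra II: full-rank GRANK gates over one field are closed
# under `∧` (block sum) and `∨` (stacked Kronecker products)

Route PneNP/ConvexRankGates, crux `Summit.PneNP.PneNP.Theses.ConvexRankGates.Capture` (lead c9, 2026-08-17;
`--supports stmt-PneNP-2659`). Kernel form of Props `GRankAndClosed` / `GRankOrClosed` of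
`Cruxes/Capture/SketchIdeator3.lean` (ideator 3, card `generic-span-hull-shadow-collapse`; unproved there) for
gates in FULL-RANK form (`v ↦ [dᵢ ≤ rank Mᵢ(v)]`, `Mᵢ(v) = K₀ⁱ + ∑_{v_t = 1} X_t K_tⁱ` square of size `dᵢ`,
same field `F`; every GRANK gate has this form over a transcendental extension by
`ConvexRankGatesCaptureGRankNormalForm.lean`):

* `and_fullRank_iff` — the block-diagonal data `A ⊕ B` (dimension `d₁ + d₂`, threshold `d₁ + d₂`) accept `v`
  iff BOTH gates do (`det (M₁ ⊕ M₂) = det M₁ · det M₂`);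
* `or_kronecker_iff` — the data `[[A ⊗ 1, 0], [1 ⊗ B, 0]]` (dimension `2 d₁ d₂`, threshold `d₁ d₂`) accept `v`
  iff AT LEAST ONE gate does. No transcendentals are needed: if `M₁` (or `M₂`) is invertible the block
  `M₁ ⊗ 1` (or `1 ⊗ M₂`) alone has rank `d₁ d₂`; if both are singular, `u ∈ ker M₁`, `w ∈ ker M₂` give the
  common kernel vector `u ⊗ w ≠ 0` of `M₁ ⊗ 1` and `1 ⊗ M₂` (`kronecker_mulVec_tmul`), so the stacked matrix
  `[M₁ ⊗ 1; 1 ⊗ M₂]` has rank `< d₁ d₂` (rank–nullity), and so has the padded square matrix.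
* Gate-level corollaries `isGRankGate_and_of_fullRank`, `isGRankGate_or_of_fullRank`.

So `{∧, ∨}`-combinations of GRANK gates over a common field are again single GRANK gates, with dimension
additive under `∧` and multiplicative under binary `∨` — correcting, per field, the informal "GRANK does not
collapse to one gate" of the `LinAlgGateBlind` docstring at the level the kernel can presently certify (full
collapse of formulas with additive `∨` needs determinant universality for ABPs, a named fact only).
No new definitions. [folklore]
-/

namespace Summit.PneNP.PneNP.Theorems.Capture.GRankAlgebra

set_option linter.dupNamespace false -- `Summit.PneNP.PneNP.…`: summit = sub-problem (D-0017)

open Literature.Computability.Complexity MvPolynomial Matrix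
open scoped Kronecker

/-! ## Linear algebra: kernels of Kronecker products, rank of a stacked matrix -/

section LinAlg

variable {L : Type*} [Field L] {p q : Type*}

/-- `(A ⊗ B) (u ⊗ w) = (A u) ⊗ (B w)` on pure tensors written as functions on the product index type.
[folklore] -/
theorem kronecker_mulVec_tmul [Fintype p] [Fintype q] (A : Matrix p p L) (B : Matrix q q L) (u : p → L)
    (w : q → L) :
    (A ⊗ₖ B) *ᵥ (fun x : p × q => u x.1 * w x.2) = fun x : p × q => (A *ᵥ u) x.1 * (B *ᵥ w) x.2 := by
  funext x
  simp only [Matrix.mulVec, dotProduct, Matrix.kroneckerMap_apply, Fintype.sum_prod_type,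
    Finset.sum_mul_sum]
  refine Finset.sum_congr rfl fun i _ => Finset.sum_congr rfl fun j _ => ?_
  ring

/-- A pure tensor of non-zero vectors is non-zero. [folklore] -/
theorem tmul_ne_zero {u : p → L} {w : q → L} (hu : u ≠ 0) (hw : w ≠ 0) :
    (fun x : p × q => u x.1 * w x.2) ≠ 0 := by
  obtain ⟨i, hi⟩ := Function.ne_iff.1 hu
  obtain ⟨j, hj⟩ := Function.ne_iff.1 hw
  intro h
  have := congrFun h (i, j)
  simp only [Pi.zero_apply, mul_eq_zero] at this
  exact this.elim hi hj

/-- A matrix with a non-zero kernel vector has rank `<` its number of columns (rank–nullity). [folklore] -/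
theorem rank_lt_card_of_mulVec_eq_zero [Fintype p] {m : Type*} [Fintype m] (T : Matrix m p L) {z : p → L}
    (hz : z ≠ 0) (hT : T *ᵥ z = 0) : T.rank < Fintype.card p := by
  have hrn := LinearMap.finrank_range_add_finrank_ker T.mulVecLin
  rw [Module.finrank_fintype_fun_eq_card] at hrn
  have hker : 0 < Module.finrank L (LinearMap.ker T.mulVecLin) := by
    rw [Module.finrank_pos_iff_exists_ne_zero]
    refine ⟨⟨z, ?_⟩, fun h => hz (congrArg Subtype.val h)⟩
    rw [LinearMap.mem_ker, Matrix.mulVecLin_apply, hT]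
  change Module.finrank L (LinearMap.range T.mulVecLin) < Fintype.card p
  omega

/-- `fromRows A C` composed with the projection onto the first block of columns is the square block matrix
`[[A, 0], [C, 0]]`. [folklore] -/
theorem fromRows_mul_fromCols_one_zero [Fintype p] [DecidableEq p] {m₁ m₂ : Type*} (A : Matrix m₁ p L)
    (C : Matrix m₂ p L) :
    Matrix.fromRows A C * Matrix.fromCols (1 : Matrix p p L) (0 : Matrix p q L) =
      Matrix.fromBlocks A 0 C 0 := by
  rw [Matrix.fromRows_mul_fromCols, Matrix.mul_one, Matrix.mul_one, Matrix.mul_zero, Matrix.mul_zero]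

/-- **Rank of the stacked Kronecker matrix.** For square `M₁` (`p × p`) and `M₂` (`q × q`) over a field, the square
block matrix `[[M₁ ⊗ 1, 0], [1 ⊗ M₂, 0]]` has rank `≥ |p|·|q|` iff `M₁` or `M₂` is non-singular. [folklore] -/
theorem card_le_rank_stacked_kronecker_iff [Fintype p] [Fintype q] [DecidableEq p] [DecidableEq q]
    (M₁ : Matrix p p L) (M₂ : Matrix q q L) :
    Fintype.card (p × q) ≤ (Matrix.fromBlocks (M₁ ⊗ₖ (1 : Matrix q q L)) (0 : Matrix (p × q) (p × q) L)
        ((1 : Matrix p p L) ⊗ₖ M₂) 0).rank ↔ M₁.det ≠ 0 ∨ M₂.det ≠ 0 := by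
  constructor
  · intro h
    by_contra hor
    push Not at hor
    obtain ⟨u, hu, hMu⟩ := Matrix.exists_mulVec_eq_zero_iff.2 hor.1
    obtain ⟨w, hw, hMw⟩ := Matrix.exists_mulVec_eq_zero_iff.2 hor.2
    -- the common kernel vector `u ⊗ w` of `M₁ ⊗ 1` and `1 ⊗ M₂`
    set z : p × q → L := fun x => u x.1 * w x.2
    have hz : z ≠ 0 := tmul_ne_zero hu hw
    have h1 : (M₁ ⊗ₖ (1 : Matrix q q L)) *ᵥ z = 0 := by
      rw [kronecker_mulVec_tmul, hMu]; funext x; simp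
    have h2 : ((1 : Matrix p p L) ⊗ₖ M₂) *ᵥ z = 0 := by
      rw [kronecker_mulVec_tmul, hMw]; funext x; simp
    have hT : Matrix.fromRows (M₁ ⊗ₖ (1 : Matrix q q L)) ((1 : Matrix p p L) ⊗ₖ M₂) *ᵥ z = 0 := by
      rw [Matrix.fromRows_mulVec, h1, h2]; funext x; cases x <;> rfl
    have hlt := rank_lt_card_of_mulVec_eq_zero _ hz hT
    rw [← fromRows_mul_fromCols_one_zero] at h
    have := Matrix.rank_mul_le_left (Matrix.fromRows (M₁ ⊗ₖ (1 : Matrix q q L)) ((1 : Matrix p p L) ⊗ₖ M₂))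
      (Matrix.fromCols (1 : Matrix (p × q) (p × q) L) (0 : Matrix (p × q) (p × q) L))
    omega
  · rintro (h | h)
    · -- `M₁ ⊗ 1` is an invertible `|p||q| × |p||q|` block
      have hdet : (M₁ ⊗ₖ (1 : Matrix q q L)).det ≠ 0 := by
        rw [Matrix.det_kronecker, Matrix.det_one, one_pow, mul_one]
        exact pow_ne_zero _ h
      have hU : IsUnit (M₁ ⊗ₖ (1 : Matrix q q L)) :=
        (Matrix.isUnit_iff_isUnit_det _).2 (isUnit_iff_ne_zero.2 hdet)
      calc Fintype.card (p × q) = (M₁ ⊗ₖ (1 : Matrix q q L)).rank := (Matrix.rank_of_isUnit _ hU).symm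
        _ = ((Matrix.fromBlocks (M₁ ⊗ₖ (1 : Matrix q q L)) (0 : Matrix (p × q) (p × q) L)
              ((1 : Matrix p p L) ⊗ₖ M₂) 0).submatrix Sum.inl Sum.inl).rank := by
            congr 1
        _ ≤ _ := Matrix.rank_submatrix_le _ _ _
    · have hdet : ((1 : Matrix p p L) ⊗ₖ M₂).det ≠ 0 := by
        rw [Matrix.det_kronecker, Matrix.det_one, one_pow, one_mul]
        exact pow_ne_zero _ h
      have hU : IsUnit ((1 : Matrix p p L) ⊗ₖ M₂) :=
        (Matrix.isUnit_iff_isUnit_det _).2 (isUnit_iff_ne_zero.2 hdet)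
      calc Fintype.card (p × q) = ((1 : Matrix p p L) ⊗ₖ M₂).rank := (Matrix.rank_of_isUnit _ hU).symm
        _ = ((Matrix.fromBlocks (M₁ ⊗ₖ (1 : Matrix q q L)) (0 : Matrix (p × q) (p × q) L)
              ((1 : Matrix p p L) ⊗ₖ M₂) 0).submatrix Sum.inr Sum.inl).rank := by
            congr 1
        _ ≤ _ := Matrix.rank_submatrix_le _ _ _

end LinAlg

/-! ## The symbolic matrices of block-sum and stacked-Kronecker data -/

section Symbolic

variable {F : Type*} [Field F] {n d₁ d₂ : ℕ}

/-- Symbolic matrix of REINDEXED data = reindexed symbolic matrix (only `Fin`-indexed data have a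
`symbolicMatrix`, so the source is written with `Matrix.of`). [folklore] -/
theorem symbolicMatrix_of_reindex {ι : Type*} {D : ℕ} (e : ι ≃ Fin D) (A₀ : Matrix ι ι F)
    (A : Fin n → Matrix ι ι F) (v : Fin n → Bool) (a b : Fin D) :
    symbolicMatrix (Matrix.reindex e e A₀) (fun t => Matrix.reindex e e (A t)) v a b =
      algebraMap F _ (A₀ (e.symm a) (e.symm b)) +
        ∑ t, if v t then algebraMap (MvPolynomial (Fin n) F) (FractionRing (MvPolynomial (Fin n) F)) (X t) *
          algebraMap F _ (A t (e.symm a) (e.symm b)) else 0 := by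
  simp only [symbolicMatrix, Matrix.add_apply, Matrix.map_apply, Matrix.reindex_apply,
    Matrix.submatrix_apply, Matrix.sum_apply]
  refine congrArg _ (Finset.sum_congr rfl fun t _ => ?_)
  split_ifs <;> simp [Matrix.smul_apply, Matrix.map_apply, Matrix.submatrix_apply]

/-- Entries of a symbolic matrix. [folklore] -/
theorem symbolicMatrix_apply {d : ℕ} (K₀ : Matrix (Fin d) (Fin d) F) (K : Fin n → Matrix (Fin d) (Fin d) F)
    (v : Fin n → Bool) (a b : Fin d) :
    symbolicMatrix K₀ K v a b = algebraMap F _ (K₀ a b) +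
      ∑ t, if v t then algebraMap (MvPolynomial (Fin n) F) (FractionRing (MvPolynomial (Fin n) F)) (X t) *
        algebraMap F _ (K t a b) else 0 := by
  simp only [symbolicMatrix, Matrix.add_apply, Matrix.map_apply, Matrix.sum_apply]
  refine congrArg _ (Finset.sum_congr rfl fun t _ => ?_)
  split_ifs <;> simp [Matrix.smul_apply, Matrix.map_apply]

/-- **Block sum.** The symbolic matrix of the block-diagonal data `A ⊕ B` is the block sum of the two symbolic
matrices. [folklore] -/
theorem symbolicMatrix_blockSum (A₀ : Matrix (Fin d₁) (Fin d₁) F) (A : Fin n → Matrix (Fin d₁) (Fin d₁) F)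
    (B₀ : Matrix (Fin d₂) (Fin d₂) F) (B : Fin n → Matrix (Fin d₂) (Fin d₂) F) (v : Fin n → Bool) :
    symbolicMatrix (Matrix.reindex finSumFinEquiv finSumFinEquiv (Matrix.fromBlocks A₀ 0 0 B₀))
        (fun t => Matrix.reindex finSumFinEquiv finSumFinEquiv (Matrix.fromBlocks (A t) 0 0 (B t))) v =
      Matrix.reindex finSumFinEquiv finSumFinEquiv
        (Matrix.fromBlocks (symbolicMatrix A₀ A v) 0 0 (symbolicMatrix B₀ B v)) := by
  ext a b
  rw [symbolicMatrix_of_reindex, Matrix.reindex_apply, Matrix.submatrix_apply]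
  rcases ha : finSumFinEquiv.symm a with a' | a' <;> rcases hb : finSumFinEquiv.symm b with b' | b' <;>
    simp [Matrix.fromBlocks_apply₁₁, Matrix.fromBlocks_apply₁₂, Matrix.fromBlocks_apply₂₁,
      Matrix.fromBlocks_apply₂₂, symbolicMatrix_apply]

/-- **Stacked Kronecker products.** The symbolic matrix of the data `[[A ⊗ 1, 0], [1 ⊗ B, 0]]` is
`[[M₁ ⊗ 1, 0], [1 ⊗ M₂, 0]]`. [folklore] -/
theorem symbolicMatrix_stackedKronecker (A₀ : Matrix (Fin d₁) (Fin d₁) F)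
    (A : Fin n → Matrix (Fin d₁) (Fin d₁) F) (B₀ : Matrix (Fin d₂) (Fin d₂) F)
    (B : Fin n → Matrix (Fin d₂) (Fin d₂) F) (v : Fin n → Bool)
    (e : (Fin d₁ × Fin d₂) ⊕ (Fin d₁ × Fin d₂) ≃ Fin (d₁ * d₂ + d₁ * d₂)) :
    symbolicMatrix (Matrix.reindex e e (Matrix.fromBlocks (A₀ ⊗ₖ (1 : Matrix (Fin d₂) (Fin d₂) F)) 0
          ((1 : Matrix (Fin d₁) (Fin d₁) F) ⊗ₖ B₀) 0))
        (fun t => Matrix.reindex e e (Matrix.fromBlocks (A t ⊗ₖ (1 : Matrix (Fin d₂) (Fin d₂) F)) 0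
          ((1 : Matrix (Fin d₁) (Fin d₁) F) ⊗ₖ B t) 0)) v =
      Matrix.reindex e e (Matrix.fromBlocks
        (symbolicMatrix A₀ A v ⊗ₖ (1 : Matrix (Fin d₂) (Fin d₂) (FractionRing (MvPolynomial (Fin n) F)))) 0
        ((1 : Matrix (Fin d₁) (Fin d₁) (FractionRing (MvPolynomial (Fin n) F))) ⊗ₖ symbolicMatrix B₀ B v)
        0) := by
  ext a b
  rw [symbolicMatrix_of_reindex, Matrix.reindex_apply, Matrix.submatrix_apply]
  rcases ha : e.symm a with a' | a' <;> rcases hb : e.symm b with b' | b'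
  · -- block `M₁ ⊗ 1`
    simp only [Matrix.fromBlocks_apply₁₁, Matrix.kroneckerMap_apply, symbolicMatrix_apply, map_mul,
      Matrix.one_apply, apply_ite (algebraMap F (FractionRing (MvPolynomial (Fin n) F))), map_one, map_zero,
      add_mul, Finset.sum_mul]
    refine congrArg _ (Finset.sum_congr rfl fun t _ => ?_)
    split_ifs <;> simp
  · simp [Matrix.fromBlocks_apply₁₂]
  · -- block `1 ⊗ M₂`
    simp only [Matrix.fromBlocks_apply₂₁, Matrix.kroneckerMap_apply, symbolicMatrix_apply, map_mul,
      Matrix.one_apply, apply_ite (algebraMap F (FractionRing (MvPolynomial (Fin n) F))), map_one, map_zero,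
      mul_add, Finset.mul_sum]
    refine congrArg _ (Finset.sum_congr rfl fun t _ => ?_)
    split_ifs <;> simp
  · simp [Matrix.fromBlocks_apply₂₂]

end Symbolic

/-! ## `∧` and `∨` of full-rank GRANK gates over one field -/

section AndOr

variable {F : Type*} [Field F] {n d₁ d₂ : ℕ}

/-- **`∧`-closure (block sum).** The block-diagonal data of dimension `d₁ + d₂` accept `v` at the full-rank
threshold iff both full-rank gates accept `v`. [folklore] -/
theorem and_fullRank_iff (A₀ : Matrix (Fin d₁) (Fin d₁) F) (A : Fin n → Matrix (Fin d₁) (Fin d₁) F)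
    (B₀ : Matrix (Fin d₂) (Fin d₂) F) (B : Fin n → Matrix (Fin d₂) (Fin d₂) F) (v : Fin n → Bool) :
    d₁ + d₂ ≤ (symbolicMatrix (Matrix.reindex finSumFinEquiv finSumFinEquiv (Matrix.fromBlocks A₀ 0 0 B₀))
        (fun t => Matrix.reindex finSumFinEquiv finSumFinEquiv (Matrix.fromBlocks (A t) 0 0 (B t))) v).rank ↔
      d₁ ≤ (symbolicMatrix A₀ A v).rank ∧ d₂ ≤ (symbolicMatrix B₀ B v).rank := by
  rw [symbolicMatrix_blockSum, le_rank_iff_det_ne_zero_of_sq, Matrix.reindex_apply, Matrix.det_submatrix_equiv_self,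
    Matrix.det_fromBlocks_zero₂₁, mul_ne_zero_iff, le_rank_iff_det_ne_zero_of_sq, le_rank_iff_det_ne_zero_of_sq]

/-- **`∨`-closure (stacked Kronecker products).** The data `[[A ⊗ 1, 0], [1 ⊗ B, 0]]` of dimension `2 d₁ d₂`
accept `v` at threshold `d₁ d₂` iff at least one of the two full-rank gates accepts `v`. [folklore] -/
theorem or_kronecker_iff (A₀ : Matrix (Fin d₁) (Fin d₁) F) (A : Fin n → Matrix (Fin d₁) (Fin d₁) F)
    (B₀ : Matrix (Fin d₂) (Fin d₂) F) (B : Fin n → Matrix (Fin d₂) (Fin d₂) F) (v : Fin n → Bool)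
    (e : (Fin d₁ × Fin d₂) ⊕ (Fin d₁ × Fin d₂) ≃ Fin (d₁ * d₂ + d₁ * d₂)) :
    d₁ * d₂ ≤ (symbolicMatrix (Matrix.reindex e e (Matrix.fromBlocks (A₀ ⊗ₖ (1 : Matrix (Fin d₂) (Fin d₂) F)) 0
          ((1 : Matrix (Fin d₁) (Fin d₁) F) ⊗ₖ B₀) 0))
        (fun t => Matrix.reindex e e (Matrix.fromBlocks (A t ⊗ₖ (1 : Matrix (Fin d₂) (Fin d₂) F)) 0
          ((1 : Matrix (Fin d₁) (Fin d₁) F) ⊗ₖ B t) 0)) v).rank ↔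
      d₁ ≤ (symbolicMatrix A₀ A v).rank ∨ d₂ ≤ (symbolicMatrix B₀ B v).rank := by
  rw [symbolicMatrix_stackedKronecker, Matrix.rank_reindex, le_rank_iff_det_ne_zero_of_sq,
    le_rank_iff_det_ne_zero_of_sq, ← card_le_rank_stacked_kronecker_iff]
  simp [Fintype.card_prod, Fintype.card_fin]

/-- **Gate-level `∧`**: two full-rank GRANK gates over the same field `F` (dimensions `d₁, d₂`) computing
`f₁, f₂` give ONE GRANK gate of dimension `d₁ + d₂` over `F` computing `f₁ ∧ f₂`. [folklore] -/
theorem isGRankGate_and_of_fullRank {F : Type} [Field F] {n d₁ d₂ : ℕ} {f₁ f₂ : (Fin n → Bool) → Bool}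
    (A₀ : Matrix (Fin d₁) (Fin d₁) F) (A : Fin n → Matrix (Fin d₁) (Fin d₁) F)
    (B₀ : Matrix (Fin d₂) (Fin d₂) F) (B : Fin n → Matrix (Fin d₂) (Fin d₂) F)
    (h₁ : ∀ v, f₁ v = true ↔ d₁ ≤ (symbolicMatrix A₀ A v).rank)
    (h₂ : ∀ v, f₂ v = true ↔ d₂ ≤ (symbolicMatrix B₀ B v).rank) :
    IsGRankGate (d₁ + d₂) ⟨n, fun v => f₁ v && f₂ v⟩ := by
  refine ⟨F, inferInstance, d₁ + d₂, d₁ + d₂, le_rfl,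
    Matrix.reindex finSumFinEquiv finSumFinEquiv (Matrix.fromBlocks A₀ 0 0 B₀),
    fun t => Matrix.reindex finSumFinEquiv finSumFinEquiv (Matrix.fromBlocks (A t) 0 0 (B t)), fun v => ?_⟩
  change (f₁ v && f₂ v) = true ↔ _
  rw [and_fullRank_iff, Bool.and_eq_true, h₁, h₂]

/-- **Gate-level `∨`**: two full-rank GRANK gates over the same field `F` (dimensions `d₁, d₂`) computing
`f₁, f₂` give ONE GRANK gate of dimension `2 d₁ d₂` (threshold `d₁ d₂`) over `F` computing `f₁ ∨ f₂` — no
transcendentals needed. [folklore] -/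
theorem isGRankGate_or_of_fullRank {F : Type} [Field F] {n d₁ d₂ : ℕ} {f₁ f₂ : (Fin n → Bool) → Bool}
    (A₀ : Matrix (Fin d₁) (Fin d₁) F) (A : Fin n → Matrix (Fin d₁) (Fin d₁) F)
    (B₀ : Matrix (Fin d₂) (Fin d₂) F) (B : Fin n → Matrix (Fin d₂) (Fin d₂) F)
    (h₁ : ∀ v, f₁ v = true ↔ d₁ ≤ (symbolicMatrix A₀ A v).rank)
    (h₂ : ∀ v, f₂ v = true ↔ d₂ ≤ (symbolicMatrix B₀ B v).rank) :
    IsGRankGate (d₁ * d₂ + d₁ * d₂) ⟨n, fun v => f₁ v || f₂ v⟩ := by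
  set e : (Fin d₁ × Fin d₂) ⊕ (Fin d₁ × Fin d₂) ≃ Fin (d₁ * d₂ + d₁ * d₂) :=
    (Equiv.sumCongr finProdFinEquiv finProdFinEquiv).trans finSumFinEquiv
  refine ⟨F, inferInstance, d₁ * d₂ + d₁ * d₂, d₁ * d₂, le_rfl,
    Matrix.reindex e e (Matrix.fromBlocks (A₀ ⊗ₖ (1 : Matrix (Fin d₂) (Fin d₂) F)) 0
      ((1 : Matrix (Fin d₁) (Fin d₁) F) ⊗ₖ B₀) 0),
    fun t => Matrix.reindex e e (Matrix.fromBlocks (A t ⊗ₖ (1 : Matrix (Fin d₂) (Fin d₂) F)) 0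
      ((1 : Matrix (Fin d₁) (Fin d₁) F) ⊗ₖ B t) 0), fun v => ?_⟩
  change (f₁ v || f₂ v) = true ↔ _
  rw [or_kronecker_iff, Bool.or_eq_true, h₁, h₂]

end AndOr

/-! ## Registered form (stub `grank_fullRank_and_or` of crux stmt-PneNP-2659) -/

/-- **Closure of full-rank GRANK gates over one field under `∧` and `∨`, closed statement** (the registered
stub). [folklore] -/
theorem grank_fullRank_and_or : ∀ (F : Type) [Field F] (n d₁ d₂ : ℕ) (f₁ f₂ : (Fin n → Bool) → Bool)
    (A₀ : Matrix (Fin d₁) (Fin d₁) F) (A : Fin n → Matrix (Fin d₁) (Fin d₁) F)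
    (B₀ : Matrix (Fin d₂) (Fin d₂) F) (B : Fin n → Matrix (Fin d₂) (Fin d₂) F),
    (∀ v, f₁ v = true ↔ d₁ ≤ (symbolicMatrix A₀ A v).rank) →
    (∀ v, f₂ v = true ↔ d₂ ≤ (symbolicMatrix B₀ B v).rank) →
      IsGRankGate (d₁ + d₂) ⟨n, fun v => f₁ v && f₂ v⟩ ∧
        IsGRankGate (d₁ * d₂ + d₁ * d₂) ⟨n, fun v => f₁ v || f₂ v⟩ :=
  fun _ _ _ _ _ _ _ A₀ A B₀ B h₁ h₂ =>
    ⟨isGRankGate_and_of_fullRank A₀ A B₀ B h₁ h₂, isGRankGate_or_of_fullRank A₀ A B₀ B h₁ h₂⟩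

end Summit.PneNP.PneNP.Theorems.Capture.GRankAlgebra
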